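import Summits.ResolutionOfSingularities.ResolutionOfSingularities.Theorems.FrobeniusClosingSteerWords11HighHalf
import Summits.ResolutionOfSingularities.ResolutionOfSingularities.Theorems.FrobeniusClosingSteerThreadKoenig

/-!
# Crux `Steer` (stmt-ResolutionOfSingularities-16345), line `switching-dichotomy` — WORDS 13: §σ2.21 THE HIGH-WANDER FOREST of the p = 2 σ_top-STEERED COMPOSITION (res-L0-w41-strat-2: `IsRootStep`, `IsChildStep`, `HeightTwoStepsInfinite`, the König split, `IsSteeredRun.monotone` …) (HOIST of the registered skeleton r38 cc5f2c8f0939be83, l.1466–1726, inside `section SteeredTwo`)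

Holder res-L0-w41-lead-1 g5 on res-L0-w41-plan-1 RULING 47 (E1) / 104b; see `…Words01Core` for the hoist protocol (bodies byte for byte;
`[cite: …]` / `[folklore]` tags on CLOSED `def … : Prop` words are written «(ref. …)» / «(folklore)» — GATE NOTE of `…Words02Stubs`;
cite keys inside `[cite:]` tags normalised to `references.bib` keys where needed, as in `…Words03Phases`).
Nothing here is a statement of the manuscript [claim: Hironaka2017, status: under-review]. OURS (candidates / vocabulary; AI review is
weaker than expert review).
-/

open Summit.ResolutionOfSingularities.ResolutionOfSingularities.Theses.FrobeniusClosing (IsolatedForcedTermination)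
open Literature.AlgebraicGeometry.Resolution (IsAbhyankarPlace FGOver exists_ringKrullDim_eq_and_trdeg_eq
  trdeg_eq_trdeg_of_isFractionRing locAtCentre IsQuadraticTransformAlong SubringDominates IsRsopPart
  LocalUniformization3 RelLocalUniformization CossartPiltant2019General)
open Summit.ResolutionOfSingularities.ResolutionOfSingularities.Theorems.SteerRankThinness
  (HasProperCoarsening concl_of_hasProperCoarsening rankOne_of_not_hasProperCoarsening)
open Summit.ResolutionOfSingularities.ResolutionOfSingularities.Theorems.PfaffLine

set_option linter.dupNamespace false

namespace Summit.ResolutionOfSingularities.ResolutionOfSingularities.Theorems.SwitchingDichotomy.Words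

section SteeredTwo

open IsLocalRing
open Literature.AlgebraicGeometry.Resolution (IsLocalBlowupAlong IsQuadraticTransform IsExcellentRing)

variable {K : Type} [Field K]


/-! ### §σ2.21 (res-L0-w41-strat-2, 08:1xZ; CLAIM 08:10:54Z) — THE HIGH-WANDER FOREST (words for RULING 13c).
Positive-dimensional centre stages of a run form a FOREST under the ANCESTOR relation «`P j` contracts onto `P i` with the same height»
(`IsAncestorStep`; ancestors of a node form a chain, so «most recent ancestor» is a parent map): ROOTS are BIRTHS (a centre none of whose
contractions to earlier members is an earlier centre of the same height), an infinite chain is a THREAD (a dominant tail is a thread with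
consecutive visits), and a node with infinitely many children is INFINITE BRANCHING (infinitely many distinct first re-births over one
centre). König (pure combinatorics, `WanderForestKoenig`): infinitely many positive steps ∧ finitely many roots ∧ finite branching ⇒ an
infinite thread. Reading (strat-2 memo §6″, CORRECTING §6′ W-f): along a thread visited NON-consecutively the germ at the thread's generic
point (dimension c ≤ 3) undergoes quadratic transforms at visits, identity off it, and MONOIDAL transforms whenever a bigger centre contains the
thread variety; finitely many monoidal hits ⇒ Ĝ (G with identity steps) + K(c); height ≤ 2 threads are hit only by divisors, which resolve
the generic point (the thread dies); a curve thread (height 3) hit by surfaces infinitely often forces infinitely many SURFACE centres, whose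
sub-forest has no infinite thread (previous case) — hence births or branching. So `ThreadWanderTwoN` is DISCHARGEABLE modulo K(1..3) and the
HIGH frontier is the BIRTH BUDGET: `BirthWanderConclTwoN` ∧ `BranchWanderConclTwoN`. OURS (candidates; AI review weaker than expert review). -/

/-- OURS (strat-2): stage `i` is a POSITIVE-DIMENSIONAL step (the centre is not the closed point). -/
def IsPosStep (R : ℕ → Subring K) (P : (i : ℕ) → Ideal (R i)) (i : ℕ) : Prop :=
  ∃ _ : IsLocalRing (R i), P i ≠ IsLocalRing.maximalIdeal (R i)

/-- OURS (strat-2): ANCESTOR relation of the centre forest — `i < j`, both positive-dimensional, `P j` contracts onto `P i`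
(`comap` along `R i ≤ R j`) and the heights agree (so `(R j)_{P j}` dominates `(R i)_{P i}` birationally with algebraic residue
extension: a point of a tower of transforms of the germ at `V(P i)`'s generic point). -/
def IsAncestorStep (R : ℕ → Subring K) (P : (i : ℕ) → Ideal (R i)) (i j : ℕ) : Prop :=
  i < j ∧ IsPosStep R P i ∧ IsPosStep R P j ∧ (P j).height = (P i).height ∧
    ∃ h : R i ≤ R j, Ideal.comap (Subring.inclusion h) (P j) = P i

/-- OURS (strat-2): a BIRTH — a positive-dimensional step with no ancestor (a root of the centre forest). -/
def IsRootStep (R : ℕ → Subring K) (P : (i : ℕ) → Ideal (R i)) (j : ℕ) : Prop :=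
  IsPosStep R P j ∧ ∀ i, ¬ IsAncestorStep R P i j

/-- OURS (strat-2): `j` is a CHILD of `i` — `i` is the most recent ancestor of `j`. -/
def IsChildStep (R : ℕ → Subring K) (P : (i : ℕ) → Ideal (R i)) (i j : ℕ) : Prop :=
  IsAncestorStep R P i j ∧ ∀ k, IsAncestorStep R P k j → k ≤ i

/-- OURS (strat-2): an infinite THREAD — infinitely many stages pairwise in the ancestor relation. -/
def HasInfiniteThread (R : ℕ → Subring K) (P : (i : ℕ) → Ideal (R i)) : Prop :=
  ∃ J : Set ℕ, J.Infinite ∧ ∀ i ∈ J, ∀ j ∈ J, i < j → IsAncestorStep R P i j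

/-- OURS (strat-2): infinitely many BIRTHS. -/
def HasInfiniteBirths (R : ℕ → Subring K) (P : (i : ℕ) → Ideal (R i)) : Prop :=
  {j | IsRootStep R P j}.Infinite

/-- OURS (strat-2): INFINITE BRANCHING — some centre has infinitely many children. -/
def HasInfiniteBranching (R : ℕ → Subring K) (P : (i : ℕ) → Ideal (R i)) : Prop :=
  ∃ i, {j | IsChildStep R P i j}.Infinite

/-- The ancestor relation is transitive (comap along composed inclusions). PROVED. OURS. [folklore] -/
theorem isAncestorStep_trans (R : ℕ → Subring K) (P : (i : ℕ) → Ideal (R i)) {i j l : ℕ}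
    (h₁ : IsAncestorStep R P i j) (h₂ : IsAncestorStep R P j l) : IsAncestorStep R P i l := by
  obtain ⟨hij, hpi, -, hh₁, e₁, hc₁⟩ := h₁
  obtain ⟨hjl, -, hpl, hh₂, e₂, hc₂⟩ := h₂
  refine ⟨hij.trans hjl, hpi, hpl, hh₂.trans hh₁, e₁.trans e₂, ?_⟩
  have hcomp : Subring.inclusion (e₁.trans e₂) = (Subring.inclusion e₂).comp (Subring.inclusion e₁) :=
    RingHom.ext fun _ => rfl
  rw [hcomp, ← Ideal.comap_comap, hc₂, hc₁]

/-- Two ancestors of one node are comparable: the earlier is an ancestor of the later (ancestors form a CHAIN, so the forest is a forest).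
Needs the run's monotonicity `R i ≤ R j`. PROVED. OURS. [folklore] -/
theorem isAncestorStep_of_common_descendant (R : ℕ → Subring K) (P : (i : ℕ) → Ideal (R i)) (hmono : Monotone R)
    {i j l : ℕ} (hij : i < j) (h₁ : IsAncestorStep R P i l) (h₂ : IsAncestorStep R P j l) : IsAncestorStep R P i j := by
  obtain ⟨-, hpi, -, hh₁, e₁, hc₁⟩ := h₁
  obtain ⟨-, hpj, -, hh₂, e₂, hc₂⟩ := h₂
  refine ⟨hij, hpi, hpj, hh₂.symm.trans hh₁, hmono hij.le, ?_⟩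
  have hcomp : Subring.inclusion e₁ = (Subring.inclusion e₂).comp (Subring.inclusion (hmono hij.le)) :=
    RingHom.ext fun _ => rfl
  rw [← hc₁, hcomp, ← Ideal.comap_comap, hc₂]

/-- **KÖNIG FOR THE CENTRE FOREST** (DISCHARGEABLE, S — pure combinatorics; idea-3 card 2's bookkeeping): infinitely many positive
steps, finitely many births and finite branching force an infinite thread (finitely many roots ⇒ a root with infinitely many descendants;
finite branching ⇒ a child with infinitely many descendants; iterate). Stated for every field and every monotone tower. OURS. (folklore) -/
def WanderForestKoenig : Prop :=
  ∀ (K : Type) [Field K] (R : ℕ → Subring K) (P : (i : ℕ) → Ideal (R i)),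
    Monotone R → {j | IsPosStep R P j}.Infinite → {j | IsRootStep R P j}.Finite →
    (∀ i, {j | IsChildStep R P i j}.Finite) → HasInfiniteThread R P

/-! (RULING 47b: the abstract König lemma `koenig_nat` of this block is NOT hoisted — res-D-pv-011 landed the same statement as
`…Theorems.SwitchingDichotomy.ThreadChain.koenig_nat` (`Theorems/FrobeniusClosingSteerThreadKoenig.lean`; gate `dedup.landed`); the consumer below
calls the tree lemma.) -/

/-- **König for the centre forest HOLDS** (adoption of the S piece in place; PROVED from the tree's `ThreadChain.koenig_nat`, `isAncestorStep_trans` and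
`isAncestorStep_of_common_descendant`). OURS. [folklore] -/
theorem wanderForestKoenig_holds : WanderForestKoenig := by
  intro K _ R P hmono hinf hroots hbr
  exact _root_.Summit.ResolutionOfSingularities.ResolutionOfSingularities.Theorems.SwitchingDichotomy.ThreadChain.koenig_nat (A := IsAncestorStep R P) (S := {j | IsPosStep R P j}) (fun h => h.1) (fun h => h.2.1)
    (fun h₁ h₂ => isAncestorStep_trans R P h₁ h₂)
    (fun hij h₁ h₂ => isAncestorStep_of_common_descendant R P hmono hij h₁ h₂) hinf hroots hbr

/-- **THREAD · ThreadWanderTwoN** (DISCHARGEABLE modulo K(1..3), L; strat-2 §6″): from a normalised start at `p = 2`, `n = 4`, rank one,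
with no dominant tail and eventually HIGH, an infinite THREAD forces infinitely many births or infinite branching (Ĝ + K(c) for finitely-hit
threads; divisor hits resolve the generic point; a curve thread hit by surfaces infinitely often yields an infinite surface sub-forest without
infinite surface thread). Why it might fail: the «identity off the thread» bookkeeping needs the iso off the closed fibre at NON-closed points of
later members (HLOST §3) and equimultiplicity `p` along the whole thread, not only at visits. OURS. (ref. HeinzerEtAl2015, Discussion 4.2)
(ref. CossartPiltant2019, Thm. 1.4 (i)) -/
def ThreadWanderTwoN : Prop :=
  ∀ p : ℕ, p = 2 →
    ∀ (k K : Type) [Field k] [CharP k p] [PerfectField k] [Field K] [Algebra k K]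
    (O : ValuationSubring K) (A₀ : Subalgebra k K) (h₀ : A₀.toSubring ≤ O.toSubring) (t : K),
    CoreDatum p 4 k K O A₀ h₀ t → ¬ HasProperCoarsening O →
    ∀ (R : ℕ → Subring K) (P : (i : ℕ) → Ideal (R i)) (s : ℕ → K),
      R 0 = locAtCentre A₀.toSubring O → NormalAt O (R 0) p t → IsSteeredRun O R P t p s →
      (¬ ∃ i₀ c : ℕ, 1 ≤ c ∧ IsDominantTail R P i₀ c) →
      (∃ i₀ : ℕ, ∀ i, i₀ ≤ i → IsHighOrderAt R s p i) →
      HasInfiniteThread R P → HasInfiniteBirths R P ∨ HasInfiniteBranching R P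

/-- **BIRTHS · BirthWanderConclTwoN** (FRONTIER — the birth budget, first half): normalised start, no dominant tail, eventually HIGH,
infinitely many BIRTHS ⇒ `Concl`. Reading: births happen only at HIGH stages, inside fresh exceptional divisors (over a point: regular
components of the cubic cone `(C_i, c_i)`; over a lower-dimensional centre: multisection components of `Sing ∩ E`); prediction P1′: at most 3
births per HIGH point step. Why it might fail: no birth invariant for positive-dimensional centres in characteristic `p` is on record
(`Literature.Barriers.ResolutionOfSingularities.DimensionFourFrontier`). OURS. (ref. CossartJannsenSaito2009, Thm. 5.25)
(ref. HeinzerEtAl2015, Discussion 4.2) -/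
def BirthWanderConclTwoN : Prop :=
  ∀ p : ℕ, p = 2 →
    ∀ (k K : Type) [Field k] [CharP k p] [PerfectField k] [Field K] [Algebra k K]
    (O : ValuationSubring K) (A₀ : Subalgebra k K) (h₀ : A₀.toSubring ≤ O.toSubring) (t : K),
    CoreDatum p 4 k K O A₀ h₀ t → ¬ HasProperCoarsening O →
    ∀ (R : ℕ → Subring K) (P : (i : ℕ) → Ideal (R i)) (s : ℕ → K),
      R 0 = locAtCentre A₀.toSubring O → NormalAt O (R 0) p t → IsSteeredRun O R P t p s →
      (¬ ∃ i₀ c : ℕ, 1 ≤ c ∧ IsDominantTail R P i₀ c) →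
      (∃ i₀ : ℕ, ∀ i, i₀ ≤ i → IsHighOrderAt R s p i) →
      HasInfiniteBirths R P → Concl O A₀ t

/-- **BRANCHING · BranchWanderConclTwoN** (FRONTIER — the birth budget, second half): normalised start, no dominant tail, eventually HIGH,
some centre with infinitely many CHILDREN (first re-births over one centre's generic point) ⇒ `Concl`. Reading: = infinitely many births of the
σ_top-run of the c-dimensional germ at that centre's generic point, c ≤ 3 — the birth budget one dimension down. Why it might fail: as for
births; additionally the germ's run is steered by the GLOBAL tie-breaks, not by a valuation of its own fraction field given in advance.
OURS. (ref. CossartPiltant2019, Thm. 1.4 (i)) (ref. HeinzerEtAl2015, Discussion 4.2) -/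
def BranchWanderConclTwoN : Prop :=
  ∀ p : ℕ, p = 2 →
    ∀ (k K : Type) [Field k] [CharP k p] [PerfectField k] [Field K] [Algebra k K]
    (O : ValuationSubring K) (A₀ : Subalgebra k K) (h₀ : A₀.toSubring ≤ O.toSubring) (t : K),
    CoreDatum p 4 k K O A₀ h₀ t → ¬ HasProperCoarsening O →
    ∀ (R : ℕ → Subring K) (P : (i : ℕ) → Ideal (R i)) (s : ℕ → K),
      R 0 = locAtCentre A₀.toSubring O → NormalAt O (R 0) p t → IsSteeredRun O R P t p s →
      (¬ ∃ i₀ c : ℕ, 1 ≤ c ∧ IsDominantTail R P i₀ c) →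
      (∃ i₀ : ℕ, ∀ i, i₀ ≤ i → IsHighOrderAt R s p i) →
      HasInfiniteBranching R P → Concl O A₀ t

/-- (r37: declared under `…Words.IsSteeredRun` so that `hrun.monotone` dot-notation survives the WORDS 06 hoist.) A steered run is a monotone tower of subrings. PROVED. OURS. [folklore] -/
theorem _root_.Summit.ResolutionOfSingularities.ResolutionOfSingularities.Theorems.SwitchingDichotomy.Words.IsSteeredRun.monotone {O : ValuationSubring K} {R : ℕ → Subring K} {P : (i : ℕ) → Ideal (R i)} {t : K} {p : ℕ}
    {s : ℕ → K} (hrun : IsSteeredRun O R P t p s) : Monotone R :=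
  monotone_nat_of_le_succ fun i => by
    obtain ⟨_, _, _, hbl, _⟩ := hrun.2 i
    exact (Literature.AlgebraicGeometry.Resolution.IsLocalBlowupAlong.isLocalBlowup hbl).le

/-- **THE FOREST SPLIT OF THE HIGH FRONTIER** (kernel glue): `HighWanderConclTwoN` ⇐ König (S) + THREAD (L, dischargeable mod K(1..3)) +
the birth budget (BIRTHS, BRANCHING: FRONTIER). Pure logic: births? else branching? else König gives a thread, which THREAD turns into births
or branching — contradiction. OURS. [folklore] -/
theorem highWanderConclTwoN_of_forest (hKoe : WanderForestKoenig) (hT : ThreadWanderTwoN) (hB : BirthWanderConclTwoN)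
    (hC : BranchWanderConclTwoN) : HighWanderConclTwoN := by
  intro p hp k K _i1 _i2 _i3 _i4 _i5 O A₀ h₀ t core hrk R P s hR0 hN hrun hnd hio hhigh
  by_cases hb : HasInfiniteBirths R P
  · exact hB p hp k K O A₀ h₀ t core hrk R P s hR0 hN hrun hnd hhigh hb
  by_cases hc : HasInfiniteBranching R P
  · exact hC p hp k K O A₀ h₀ t core hrk R P s hR0 hN hrun hnd hhigh hc
  exfalso
  have hinf : {j | IsPosStep R P j}.Infinite := by
    refine Set.infinite_of_not_bddAbove ?_
    rintro ⟨b, hb'⟩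
    obtain ⟨i, hi, hnp⟩ := hio (b + 1)
    obtain ⟨hl, -⟩ := hrun.2 i
    have := hb' (show i ∈ {j | IsPosStep R P j} from ⟨hl, fun h => hnp ⟨hl, h⟩⟩)
    omega
  have hroots : {j | IsRootStep R P j}.Finite := Set.not_infinite.mp hb
  have hbr : ∀ i, {j | IsChildStep R P i j}.Finite := fun i => Set.not_infinite.mp fun h => hc ⟨i, h⟩
  rcases hT p hp k K O A₀ h₀ t core hrk R P s hR0 hN hrun hnd hhigh (hKoe K R P hrun.monotone hinf hroots hbr) with h | h
  · exact hb h
  · exact hc h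

/-- **THE HIGH FRONTIER = THE BIRTH BUDGET** (König discharged in place): `HighWanderConclTwoN` ⇐ THREAD (L, dischargeable mod K(1..3)) +
BIRTHS + BRANCHING. Pure logic. OURS. [folklore] -/
theorem highWanderConclTwoN_of_budget (hT : ThreadWanderTwoN) (hB : BirthWanderConclTwoN) (hC : BranchWanderConclTwoN) :
    HighWanderConclTwoN :=
  highWanderConclTwoN_of_forest wanderForestKoenig_holds hT hB hC

/-- … so T ⇐ NormalisedStart, PointTailHigh (B13 slate), König, THREAD, BIRTHS, BRANCHING, LOWᴺ + two named facts (r24 form).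
Pure logic. OURS. [folklore] -/
theorem eternalSteeredRunTwo_of_normalised_forest_debts (hNS : NormalisedStartTwo)
    (hP : PointTailHighConclTwo) (hKoe : WanderForestKoenig) (hT : ThreadWanderTwoN) (hB : BirthWanderConclTwoN)
    (hC : BranchWanderConclTwoN) (hLow : LowOrderTailConclTwoN)
    (hL : Literature.AlgebraicGeometry.Resolution.Lipman1978NoEternalNormalBranch.{0})
    (hCP : Literature.AlgebraicGeometry.Resolution.CossartPiltant2019HironakaLUIsolatedBranch.{0}) : EternalSteeredRunTwo :=
  eternalSteeredRunTwo_of_normalised_split_debts hNS hP (highWanderConclTwoN_of_forest hKoe hT hB hC) hLow hL hCP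

/-- … with König discharged in place (r24 form): T ⇐ NormalisedStart, PointTailHigh, THREAD, BIRTHS, BRANCHING, LOWᴺ + two named facts. OURS. [folklore] -/
theorem eternalSteeredRunTwo_of_normalised_budget_debts (hNS : NormalisedStartTwo)
    (hP : PointTailHighConclTwo) (hT : ThreadWanderTwoN) (hB : BirthWanderConclTwoN)
    (hC : BranchWanderConclTwoN) (hLow : LowOrderTailConclTwoN)
    (hL : Literature.AlgebraicGeometry.Resolution.Lipman1978NoEternalNormalBranch.{0})
    (hCP : Literature.AlgebraicGeometry.Resolution.CossartPiltant2019HironakaLUIsolatedBranch.{0}) : EternalSteeredRunTwo :=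
  eternalSteeredRunTwo_of_normalised_forest_debts hNS hP wanderForestKoenig_holds hT hB hC hLow hL hCP


end SteeredTwo

end Summit.ResolutionOfSingularities.ResolutionOfSingularities.Theorems.SwitchingDichotomy.Words
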